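import Summits.QuantumAdvantage.AdviceFreeQNC0.FibreDecimation37MOne
import HarnessLib

/-!
# Cell qa-qnc0, `p = 3` — the typed `Exp37.FibreNonExact37NHS` (§3.8 (ii), all odd `m`) is FALSE at `m = 1` as well

The `m = 1` witness of `FibreDecimation37MOne.lean` (`CexM1`: `z = 18`, chosen coin `c₀ = 0` with letter `1`, test `k₀` all-ones, `17` blind
tests `1_Y + e_c`, residues `0`) with NO label forms (`R = 0`, `h ≡ false`): then (NH/S) is (NH) (the label sum is empty, the pair index set is
`{(j, γ₀)}`), and the mixed parity is the plain test parity, which agrees with the target `0` on all of `H_0`.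

* `nhsCond_cex`, **`not_fibreNonExact37NHS : ¬ FibreNonExact37NHS`** (the `3 ≤ m` form `FibreNonExact37NHSThree` holds: `FibreDecimation37ThreeLe.lean`).

WHAT THIS IS NOT: no statement about the game.
-/

noncomputable section

namespace Summit.QuantumAdvantage.AdviceFreeQNC0.Exp37

open Finset
open Summit.QuantumAdvantage.AdviceFreeQNC0 F4

namespace CexM1

variable {N : ℕ}

/-- With no label forms the combined outside form of a pair `(j, γ)` is that of `j`. -/
theorem weightYDir_noLabel (j : Fin (N + 1) → ZMod 3) (γ : Fin 0 → ZMod 3) (S₀ : Fin 0 → Fin (N + 1) → ZMod 3) :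
    weightYDir (ιc N) (fun c => (∑ k, j k * βc N k c) + ∑ i, γ i * S₀ i c) = weightY (ιc N) (βc N) j := by
  unfold weightYDir weightY
  congr 1
  refine filter_congr fun c _ => ?_
  simp

/-- **(NH/S) holds for the witness with no label forms** once `2(3/4)^N ≤ 1/50` and `N ≥ 6`. -/
theorem nhsCond_cex (h6 : 6 ≤ N) (hnum : 2 * ((3 : ℝ) / 4) ^ N ≤ 1 / 50) (S₀ : Fin 0 → Fin (N + 1) → ZMod 3) :
    NHSCond (ιc N) ac (βc N) S₀ := by
  classical
  unfold NHSCond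
  rw [decimSet_cex, card_singleton]
  refine ⟨by omega, ?_⟩
  set P := (univ : Finset ((Fin (N + 1) → ZMod 3) × (Fin 0 → ZMod 3))).filter
    (fun jγ => jγ ≠ 0 ∧ ∀ k, k ∉ ({0} : Finset (Fin (N + 1))) → jγ.1 k = 0) with hPdef
  have hγ : ∀ γ γ' : Fin 0 → ZMod 3, γ = γ' := fun γ γ' => funext fun i => Fin.elim0 i
  have hP : ∀ jγ ∈ P, jγ.1 ≠ 0 ∧ ∀ k, k ≠ 0 → jγ.1 k = 0 := by
    intro jγ hj
    obtain ⟨-, hj0, hjk⟩ := mem_filter.1 hj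
    refine ⟨fun h0 => hj0 ?_, fun k hk => hjk k (by rwa [mem_singleton])⟩
    exact Prod.ext h0 (hγ _ _)
  -- every term has weight `N`
  have hterm : ∀ jγ ∈ P, ((3 : ℝ) / 4) ^ weightYDir (ιc N) (fun c => (∑ k, jγ.1 k * βc N k c) + ∑ i, jγ.2 i * S₀ i c) =
      ((3 : ℝ) / 4) ^ N := by
    intro jγ hj
    rw [weightYDir_noLabel, weightY_cex jγ.1 (hP jγ hj).1 (hP jγ hj).2]
  -- at most two pairs
  have hcard : P.card ≤ 2 := by
    set γ₀ : Fin 0 → ZMod 3 := fun i => Fin.elim0 i with hγ₀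
    have hsub : P ⊆ ({(Pi.single 0 1, γ₀), (Pi.single 0 2, γ₀)} : Finset ((Fin (N + 1) → ZMod 3) × (Fin 0 → ZMod 3))) := by
      intro jγ hjP
      obtain ⟨hj0, hj⟩ := hP jγ hjP
      have hshape : jγ.1 = Pi.single 0 (jγ.1 0) := by
        funext k
        by_cases hk : k = 0
        · rw [hk, Pi.single_eq_same]
        · rw [Pi.single_eq_of_ne hk, hj k hk]
      have hj00 : jγ.1 0 ≠ 0 := by
        intro h; apply hj0; rw [hshape, h, Pi.single_zero]
      rw [mem_insert, mem_singleton]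
      rcases zmod3_cases (jγ.1 0) with h | h | h
      · exact absurd h hj00
      · left; exact Prod.ext (by rw [hshape, h]) (hγ _ _)
      · right; exact Prod.ext (by rw [hshape, h]) (hγ _ _)
    exact (card_le_card hsub).trans (card_insert_le _ _ |>.trans (by rw [card_singleton]))
  calc ∑ jγ ∈ P, ((3 : ℝ) / 4) ^ weightYDir (ιc N) (fun c => (∑ k, jγ.1 k * βc N k c) + ∑ i, jγ.2 i * S₀ i c)
      = ∑ jγ ∈ P, ((3 : ℝ) / 4) ^ N := sum_congr rfl hterm
    _ = P.card * ((3 : ℝ) / 4) ^ N := by rw [sum_const, nsmul_eq_mul]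
    _ ≤ 2 * ((3 : ℝ) / 4) ^ N := mul_le_mul_of_nonneg_right (by exact_mod_cast hcard) (by positivity)
    _ ≤ 1 / 50 := hnum

end CexM1

open CexM1

/-- **The typed `FibreNonExact37NHS` (§3.8 (ii) as typed, all odd `m`) is FALSE**: the `m = 1` witness with no label forms. -/
theorem not_fibreNonExact37NHS : ¬ FibreNonExact37NHS := by
  intro h
  have hnum : 2 * ((3 : ℝ) / 4) ^ 17 ≤ 1 / 50 := by norm_num
  set S₀ : Fin 0 → Fin 18 → ZMod 3 := fun i => Fin.elim0 i with hS₀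
  have hmain := h 18 18 1 0 (ιc 17) (βc 17) (rc 17) 0 ac S₀ (fun _ => false) ⟨0, rfl⟩ (by norm_num) pattern_cex
    (nhsCond_cex (by norm_num) hnum S₀) 0 0 ∅
  have hodd : Odd 17 := ⟨8, by norm_num⟩
  have hcount := card_agree_cex (N := 17) hodd
  have e : ((coset 18 0).filter fun u =>
      (testParity (βc 17) (rc 17) u + (if (fun _ : Fin 0 → ZMod 3 => false) (labelVal S₀ u) then 1 else 0)) % 2 =
        affTarget 0 ∅ u % 2) =
      (coset 18 0).filter fun u => testParity (βc 17) (rc 17) u % 2 = affTarget 0 ∅ u % 2 := by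
    refine filter_congr fun u _ => ?_
    simp
  rw [e, hcount] at hmain
  norm_num at hmain

end Summit.QuantumAdvantage.AdviceFreeQNC0.Exp37

end
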